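import Summits.BirchSwinnertonDyer.BirchSwinnertonDyer.Theorems.QuadraticBranchSignedControlEtaTransportPlusOfDecomposition
import Summits.BirchSwinnertonDyer.BirchSwinnertonDyer.Theses.QuadraticBranchSignedControl
import Summits.BirchSwinnertonDyer.Rank1Residual.Additive.QuadraticBranchPlusKatoDivisibility
import Summits.BirchSwinnertonDyer.Rank1Residual.Additive.CyclotomicTowerSignedSelmerDual
import Summits.BirchSwinnertonDyer.Rank1Residual.Additive.SignedTwistOddBranchReadings
import Summits.BirchSwinnertonDyer.Rank1Residual.Additive.ChiEigenPrimeToPDescentGenerator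
import Literature.NumberTheory.EllipticCurves.Kobayashi2003.SignedSelmerDualUniquenessProofs
import Literature.NumberTheory.EllipticCurves.Kobayashi2003.SignedSelmerTorsion
import Literature.NumberTheory.EllipticCurves.IwasawaSelmerIsTorsionProofs
import Literature.NumberTheory.EllipticCurves.IwasawaSelmerProofs
import HarnessLib

/-!
# Route `QuadraticBranchSignedControl` (rung K8, cell `bsd-potss`), crux `PlusMainConjectureBranch`
# (item stmt-BirchSwinnertonDyer-19114): the TWO SEAMS of the crux in the kernel —
# (§1) Kato half / Eisenstein half, (§2) `F`-form / `η`-component form (the converse of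
# `etaTransportPlus_of_decomposition`)

WHAT. The crux (C1_η) `PlusMainConjectureBranch` (`∀ V p, 5 ≤ p → good → a_p = 0 →
QuadraticBranchPlusMainConjectureAt V p`: Kobayashi's EVEN main conjecture at the quadratic character
`η = ω^{(p−1)/2}`, typed over `F = ℚ(√p*)`) is an open problem for non-CM `V` (seat k8q-c2's FIND
memo, item evidence `FIND-19114-k8q-c2.md`: the Kato inclusion `⊇` is Kobayashi 2003 Thm. 4.1 for
EVERY `η`; the Eisenstein inclusion `⊆` is open on every non-CM row and a printed REMARK of
Pollack–Rubin on the CM rows). This file proves, in the kernel, the two decompositions along which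
the item can be re-cut:

* **§1 (print seam).** `PlusMainConjectureBranch` ⟹ the ∀-closure of the Eisenstein half (E⁺)
  `QuadraticBranchPlusLowerInclusionAt`; conversely the ∀-closures of the Kato-half READING (RK⁺)
  `QuadraticBranchPlusKatoDivisibilityAt` (Thm. 2.2 + 4.1 at `η`, theorem in print) and of (E⁺) give
  `PlusMainConjectureBranch` on the surjective-image rows, the remaining rows (CM, small image: Thm.
  4.1 gives only `pⁿ` there) being displayed as the hypothesis `hres`
  (`Additive/QuadraticBranchPlusKatoDivisibility.lean`, this seat).
* **§2 (currency seam).** GRANTED the prime-to-`p` descent frame in its ∀-form `hdec` (for EVERY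
  quadratic model `(F, V', κF, γF)` admissible for (C1_η) and `K₀ = ℚ(μ_p)`, a `Γ`-equivariant
  additive isomorphism `Sel⁺(V'/F_∞) ≃ Sel⁺(V/ℚ_∞) × Sel⁺(V/K₀ℚ_∞)^η` — the SAME frame as seat
  k8q-c3's `etaTransportPlus_of_decomposition`, which displays its ∃-form; it is the reading flag
  `Kob03-MC-eta-quadratic-subtower` of the node, WANTED on the cell bus, not proved here) and
  Kobayashi's Thm. 1.2 over `ℚ_∞` (NAMED Literature fact `Kobayashi2003.thm12_signedSelmerDual_finite_torsion`),
  **the VERBATIM `η`-component even main conjecture** `hMCη` — "`Char(X⁺(E/K_∞)^η) = (L_p⁺(E, η, X))`"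
  (§4 p. 8) on cc-typer-6's object `EtaSignedSelmerDualData V κ K₀ ℚ_[p] η γ 1`, with NO (C1_η)
  antecedent — **implies `PlusMainConjectureBranch`**. Together with k8q-c3's theorem ((C1_η) + frame
  ⟹ `η`-form) the `F`-form crux and the verbatim `η`-form are EQUIVALENT modulo the frame and Thm.
  1.2: the route needs ONE of them.

PROOF of §2 (the `Λ`-algebra, dual to k8q-c3's (i-g)). Given the binders of (C1_η) at `(V, p)` — in
particular ARBITRARY dual data `D` of `Sel⁺(V/ℚ_∞)` at `γ` and `DF` of `Sel⁺(V'/F_∞)` at `γF` —: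
take `K₀ = ℚ(μ_p)`, `η` (`exists_theta_eta_cyclotomicField`), move `γ` to `γ' ∈ Gal(ℚ̄/K₀)` with
`κ γ' = κ γ` (`kappa_surjOn_galRange_cyclotomic`; `conj_{γ'} = conj_γ` on `H¹(ℚ_∞, V[p^∞])` since
`γ⁻¹γ' ∈ ker κ` acts trivially — `conjH1_mul_holds`, `conjH1_of_mem_holds`; the cyclotomic variable
survives, `isCyclotomicVariable_of_inv_mul_mem_ker`); take the EXISTING `η`-datum `Dη` at `γ'`
(`etaSignedSelmerDualData`) and the frame's `Φ`; BUILD the product datum `DF'` of `Sel⁺(V'/F_∞)` on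
`D.X × Dη.X` (character group of a direct sum, `bijective_dualOfProd`; `T = γF − 1` by equivariance);
`D.X` is finitely generated torsion by Thm. 1.2, `Dη.X` by `hMCη` with `Char = (Lη)`; so the product
is finitely generated torsion with `Char = Char D.X · (Lη)` (`charIdeal_mul_of_shortExact_holds`); and
`DF.X ≃ₗ[Λ] DF'.X` by UNIQUENESS of signed dual data (`SignedSelmerDualData.exists_linearEquiv`),
along which finite generation, torsion and `Char` transport (`Module.charIdeal_eq_of_linearEquiv`).

HONEST FRAMING (cell `bsd-potss`, run/shared/lean/pub/bsd-potss/; FULL-BSD rank ≤ 1 programme):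
TOOL THEOREMS ONLY — no definition, no named fact minted, no `sorry`, axioms standard. Every theorem
is CONDITIONAL on displayed hypotheses (the reading (RK⁺), the open (E⁺), the frame `hdec`, the
conjecture `hMCη`, the named fact `h12`); the crux / the item / the route are NOT closed; nothing
is booked; `BSD(W, p)` is claimed for no pair; this is not "finishing BSD". Seat `bsd-potss-k8q-c2`
(prover), g0; `--supports stmt-BirchSwinnertonDyer-19114`.

References: [Kobayashi2003] Thm. 1.2 (p. 2), Def. 2.1 + Thm. 2.2 (p. 5), §3 (p. 5), §4 Even main
conjecture + Thm. 4.1 (p. 8), Thm. 7.4 (p. 13); [GreenbergLNM1716] §1 (p. 60), §3 (descent);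
[Washington1997] §13.2 (characteristic ideals); [PollackRubin2004] p. 448 (CM remark).
-/

set_option autoImplicit false
set_option linter.dupNamespace false

noncomputable section

open scoped Classical MatrixGroups ModularForm

open CongruenceSubgroup Field WeierstrassCurve
open Literature.NumberTheory.EllipticCurves
open Literature.NumberTheory.EllipticCurves.ModularForms
open Literature.NumberTheory.EllipticCurves.Kobayashi2003 hiding towerSignedSelmerInftyEta towerTopSubgroup EtaSignedSelmerDualData
  IsQuadraticBranchPlusLFunction
open Literature.NumberTheory.GaloisRepresentations
open Summit.BirchSwinnertonDyer.Rank1Residual.Additive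
open Summit.BirchSwinnertonDyer.Rank1Residual.Additive.SignedTwist
open Summit.BirchSwinnertonDyer.BirchSwinnertonDyer.Theses.QuadraticBranchSignedControl

namespace Summit.BirchSwinnertonDyer.BirchSwinnertonDyer.Theorems

/-! ## §1 The print seam: Kato half (in print) / Eisenstein half (open) -/

/-- **The crux implies the ∀-closure of its Eisenstein half** (E⁺) — the statement a re-cut item
`PlusLowerInclusionBranch` would carry; modus ponens on the crux (hypothesis position), nothing
booked. [cite: Kobayashi2003, §4 Even main conjecture (p. 8); shape only] -/
theorem plusLowerInclusion_of_plusMainConjectureBranch (h : PlusMainConjectureBranch) :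
    ∀ (V : WeierstrassCurve ℚ) [V.IsElliptic] [V.IsGloballyMinimal] (p : ℕ) [Fact p.Prime],
      5 ≤ p → V.HasGoodReductionAtPrime p → V.frobeniusTrace p = 0 →
        QuadraticBranchPlusLowerInclusionAt V p :=
  fun V _ _ p _ hp hgood hap =>
    quadraticBranchPlusLowerInclusionAt_of_plusMainConjectureAt (h V p hp hgood hap)

/-- **The crux FROM its two halves, re-cut at the print seam.** Granted, for every `V`, `p ≥ 5`
good with `a_p = 0`: (i) the READING (RK⁺) of Kobayashi's Thm. 2.2 + 4.1 at `η` (theorem in print;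
`hK`), (ii) the OPEN Eisenstein inclusion (E⁺) (`hE`), and (iii) on the rows where the `p`-adic
representation of `V` is NOT onto (the CM rows and finitely many small-image pairs, where Thm. 4.1
only gives `pⁿ`) the full (C1_η) displayed as `hres` — the route decl
`Summit.BirchSwinnertonDyer.BirchSwinnertonDyer.Theses.QuadraticBranchSignedControl.PlusMainConjectureBranch`
follows (surjective rows: `quadraticBranchPlusMainConjectureAt_of_katoDivisibility_of_lowerInclusion`).
CONDITIONAL on the three displayed inputs; closes nothing.
[cite: Kobayashi2003, Thm. 2.2 (p. 5), Thm. 4.1 and §4 Even main conjecture (p. 8)] -/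
theorem plusMainConjectureBranch_of_katoDivisibility_of_lowerInclusion_of_nonSurjective
    (hK : ∀ (V : WeierstrassCurve ℚ) [V.IsElliptic] [V.IsGloballyMinimal] (p : ℕ) [Fact p.Prime],
      5 ≤ p → V.HasGoodReductionAtPrime p → V.frobeniusTrace p = 0 →
        QuadraticBranchPlusKatoDivisibilityAt V p)
    (hE : ∀ (V : WeierstrassCurve ℚ) [V.IsElliptic] [V.IsGloballyMinimal] (p : ℕ) [Fact p.Prime],
      5 ≤ p → V.HasGoodReductionAtPrime p → V.frobeniusTrace p = 0 →
        QuadraticBranchPlusLowerInclusionAt V p)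
    (hres : ∀ (V : WeierstrassCurve ℚ) [V.IsElliptic] [V.IsGloballyMinimal] (p : ℕ) [Fact p.Prime],
      5 ≤ p → V.HasGoodReductionAtPrime p → V.frobeniusTrace p = 0 →
        ¬ (∀ m : ℕ, V.HasSurjectiveModNGaloisRep (p ^ m : ℕ)) →
        QuadraticBranchPlusMainConjectureAt V p) :
    PlusMainConjectureBranch := by
  intro V _ _ p _ hp hgood hap
  by_cases hsurj : ∀ m : ℕ, V.HasSurjectiveModNGaloisRep (p ^ m : ℕ)
  · exact quadraticBranchPlusMainConjectureAt_of_katoDivisibility_of_lowerInclusion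
      (hK V p hp hgood hap) hsurj (hE V p hp hgood hap)
  · exact hres V p hp hgood hap hsurj

/-! ## §2 The currency seam: the `F`-form crux FROM the verbatim `η`-component even main conjecture -/

/-- The product of two torsion `Λ`-modules is torsion (`Λ = ℤ_p⟦T⟧`; `(a·b)·(x, y) = 0` if
`a·x = 0`, `b·y = 0`). Pure algebra. [folklore] -/
theorem isTorsion_prod_of_isTorsion {p : ℕ} [Fact p.Prime] {X₀ X₁ : Type}
    [AddCommGroup X₀] [Module (IwasawaAlgebra p) X₀] [AddCommGroup X₁] [Module (IwasawaAlgebra p) X₁]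
    (h₀ : Module.IsTorsion (IwasawaAlgebra p) X₀) (h₁ : Module.IsTorsion (IwasawaAlgebra p) X₁) :
    Module.IsTorsion (IwasawaAlgebra p) (X₀ × X₁) := by
  intro x
  obtain ⟨a, ha⟩ := @h₀ x.1
  obtain ⟨b, hb⟩ := @h₁ x.2
  refine ⟨a * b, ?_⟩
  rw [Submonoid.smul_def] at ha hb ⊢
  refine Prod.ext ?_ ?_
  · rw [Prod.smul_fst, Submonoid.coe_mul, mul_comm, mul_smul, ha, smul_zero, Prod.fst_zero]
  · rw [Prod.smul_snd, Submonoid.coe_mul, mul_smul, hb, smul_zero, Prod.snd_zero]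

/-- **(C1_η) AT A PAIR from the verbatim `η`-component even main conjecture, granted the descent
frame and Kobayashi's Thm. 1.2 — abstract cyclotomic model `K₀`.** For `V/ℚ`, `p`, a cyclotomic
model `K₀ ⊇ ℚ(μ_p)` (`IsCyclotomicExtension {p} ℚ K₀`, `Gal(ℚ̄/K₀)` normal) and a character `ηq`
(MEANT: the quadratic character of `Gal(K₀/ℚ)`; its two defining properties are not used in the
algebra below and are therefore not asked for): IF (`h12`) Kobayashi's Thm. 1.2 (the NAMED fact
`thm12_signedSelmerDual_finite_torsion`: `X⁺(V/ℚ_∞)` finitely generated `Λ`-torsion), (`hdec`) for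
every quadratic model `(F, V', κF, γF)` admissible for (C1_η) and every generator `γ ∈ Gal(ℚ̄/K₀)`
matching the variable there is an additive isomorphism
`Φ : Sel⁺(V'/F_∞) ≃ Sel⁺(V/ℚ_∞) × Sel⁺(V/K₀ℚ_∞)^{ηq}` intertwining `conj_{γF}` with `conj_γ` on both
factors (the prime-to-`p` descent frame of the reading flag `Kob03-MC-eta-quadratic-subtower`, in
∀-form; NOT proved here — WANTED), and (`hMCη`) Kobayashi's even main conjecture AT `η` holds on the
`η`-component object (`∀ D : EtaSignedSelmerDualData V κ K₀ ℚ_[p] ηq γ 1`, finitely generated,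
torsion, `Char = (Lη)` for ANY `Lη` with the interpolation property of `L_p⁺(V, η, X)` — §4 p. 8
verbatim; an OPEN CONJECTURE in hypothesis position), THEN `QuadraticBranchPlusMainConjectureAt V p`.
Proof: module docstring (move `γ` into `Gal(ℚ̄/K₀)`, product datum on `D.X × Dη.X`, uniqueness of
signed dual data, multiplicativity of `Char`). CONDITIONAL; nothing asserted; closes nothing.
[cite: Kobayashi2003, Thm. 1.2 (p. 2), Def. 2.1 and Thm. 2.2 (p. 5), §3 (p. 5), §4 Even main conjecture (p. 8)]
[cite: GreenbergLNM1716, §1 (p. 60) and §3 (descent in prime-to-p extensions; reading)]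
[cite: Washington1997, §13.2 (characteristic ideals over Λ)] -/
theorem quadraticBranchPlusMainConjectureAt_of_etaPlusMainConjecture_of_decomposition
    {V : WeierstrassCurve ℚ} [V.IsElliptic] [V.IsGloballyMinimal] {p : ℕ} [Fact p.Prime]
    (h12 : thm12_signedSelmerDual_finite_torsion)
    (K₀ : Type) [Field K₀] [NumberField K₀] [IsCyclotomicExtension {p} ℚ K₀]
    [(galRange (K := ℚ) K₀).Normal] (ηq : absoluteGaloisGroup ℚ →* ℤˣ)
    (hdec : ∀ (κ : ZpExtension ℚ p) (γ : absoluteGaloisGroup ℚ),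
        κ.IsCyclotomic → κ.IsTopGenerator γ → γ ∈ galRange (K := ℚ) K₀ →
        IsCyclotomicVariable p γ →
      ∀ (F : Type) [Field F] [NumberField F] (V' : WeierstrassCurve F) [V'.IsElliptic]
        (κF : ZpExtension F p) (γF : absoluteGaloisGroup F),
        Module.finrank ℚ F = 2 → (∃ θ : F, θ ^ 2 = algebraMap ℚ F ((-1) ^ (p / 2) * p)) →
        (∃ C : VariableChange F, C • V.baseChange F = V') →
        κF.IsCyclotomic → κF.IsTopGenerator γF →
        (∃ ζ : ℤ_[p]ˣ, IsOfFinOrder ζ ∧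
          ((GaloisRep.cyclotomicCharacter F p γF * ζ : ℤ_[p]ˣ) : ℤ_[p]) =
            (cyclotomicGenerator p : ℤ_[p])) →
      ∃ Φ : signedSelmerInfty V' κF 1 ≃+
          signedSelmerInfty V κ 1 × towerSignedSelmerInftyEta V κ K₀ ℚ_[p] ηq 1,
        ∀ s : signedSelmerInfty V' κF 1,
          ((Φ ⟨V'.conjH1 p κF.kerSubgroup γF s,
              conjH1_mem_signedSelmerInfty V' κF 1 γF s.2⟩).1 : V.subgroupH1 p κ.kerSubgroup) =
            V.conjH1 p κ.kerSubgroup γ (Φ s).1 ∧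
          ((Φ ⟨V'.conjH1 p κF.kerSubgroup γF s,
              conjH1_mem_signedSelmerInfty V' κF 1 γF s.2⟩).2 :
              V.subgroupH1 p (towerTopSubgroup κ K₀)) =
            V.conjH1 p (towerTopSubgroup κ K₀) γ (Φ s).2)
    (hMCη : ∀ {N : ℕ} [NeZero N] {f : CuspForm (Gamma0 N) 2},
        p ≠ 2 → V.HasGoodReductionAtPrime p → V.frobeniusTrace p = 0 → IsNewformOf V f →
      ∀ (ϖ : ℚ), (if Even (p / 2) then (ϖ : ℝ) * V.realPeriodRat = plusPeriod f
          else (ϖ : ℝ) * V.imaginaryPeriodRat = minusPeriod f) →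
      ∀ (Lη : IwasawaAlgebra p), IsQuadraticBranchPlusLFunction f p ϖ Lη →
      ∀ (κ : ZpExtension ℚ p) (γ : absoluteGaloisGroup ℚ),
        κ.IsCyclotomic → κ.IsTopGenerator γ → γ ∈ galRange (K := ℚ) K₀ →
        IsCyclotomicVariable p γ →
      ∀ (D : EtaSignedSelmerDualData V κ K₀ ℚ_[p] ηq γ 1),
        Module.Finite (IwasawaAlgebra p) D.X ∧ Module.IsTorsion (IwasawaAlgebra p) D.X ∧
          D.charIdeal = Ideal.span {Lη}) :
    QuadraticBranchPlusMainConjectureAt V p := by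
  intro F _ _ V' _ κ γ κF γF N _ f hp2 hgood hap hF hθ hC hκ hγ hγc hκF hγF hζ hf ϖ hϖ Lη hL D DF
  -- move `γ` inside `Gal(ℚ̄/K₀)` keeping `κ γ`
  have hκ₀ := kappa_surjOn_galRange_cyclotomic κ K₀
  obtain ⟨γ', hγ'K, hγ'κ⟩ := hκ₀ (κ γ)
  have hγγ' : γ⁻¹ * γ' ∈ κ.kerSubgroup := by
    rw [ZpExtension.mem_kerSubgroup, map_mul, map_inv, hγ'κ, inv_mul_cancel]
  have hγ' : κ.IsTopGenerator γ' := by rw [ZpExtension.IsTopGenerator, hγ'κ]; exact hγ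
  have hγ'c : IsCyclotomicVariable p γ' := isCyclotomicVariable_of_inv_mul_mem_ker hκ hγγ' hγc
  -- `conj_{γ'} = conj_γ` on `H¹(ℚ_∞, V[p^∞])`
  have hconj : ∀ s : V.subgroupH1 p κ.kerSubgroup,
      V.conjH1 p κ.kerSubgroup γ' s = V.conjH1 p κ.kerSubgroup γ s := by
    intro s
    have hmul := V.conjH1_mul_holds p κ.kerSubgroup γ (γ⁻¹ * γ')
    rw [mul_inv_cancel_left] at hmul
    rw [hmul, AddMonoidHom.comp_apply, V.conjH1_of_mem_holds p κ.kerSubgroup hγγ',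
      AddMonoidHom.id_apply]
  -- the decomposition frame at `(κ, γ', F, V', κF, γF)`
  obtain ⟨Φ, hΦ⟩ := hdec κ γ' hκ hγ' hγ'K hγ'c F V' κF γF hF hθ hC hκF hγF hζ
  -- an `η`-component dual datum at `γ'` (EXISTS)
  obtain ⟨Dη⟩ := nonempty_etaSignedSelmerDualData V κ K₀ ℚ_[p] ηq 1 hκ₀ hγ' hγ'K
  -- the two inputs: Thm. 1.2 for `D`, the `η`-component even main conjecture for `Dη`
  obtain ⟨hDfin, hDtor⟩ := h12 V p hp2 hgood hap κ γ hκ hγ 1 D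
  obtain ⟨hηfin, hηtor, hηchar⟩ := hMCη hp2 hgood hap hf ϖ hϖ Lη hL κ γ' hκ hγ' hγ'K hγ'c Dη
  -- the character group of the direct sum
  let π₀ : signedSelmerInfty V' κF 1 →+ signedSelmerInfty V κ 1 :=
    (AddMonoidHom.fst _ _).comp Φ.toAddMonoidHom
  let π₁ : signedSelmerInfty V' κF 1 →+ towerSignedSelmerInftyEta V κ K₀ ℚ_[p] ηq 1 :=
    (AddMonoidHom.snd _ _).comp Φ.toAddMonoidHom
  let T : D.X × Dη.X →+ (signedSelmerInfty V' κF 1 →+ AddCircle (1 : ℚ)) :=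
    AddMonoidHom.mk' (fun x => (D.toDual x.1).comp π₀ + (Dη.toDual x.2).comp π₁) (by
      intro x y
      simp only [Prod.fst_add, Prod.snd_add, map_add, AddMonoidHom.add_comp]
      abel)
  have hT : ∀ (x : D.X × Dη.X) (s : signedSelmerInfty V' κF 1),
      T x s = D.toDual x.1 (Φ s).1 + Dη.toDual x.2 (Φ s).2 := fun x s => rfl
  have hTbij : Function.Bijective T :=
    bijective_dualOfProd Φ D.toDual Dη.toDual D.bijective Dη.bijective
  -- the product datum of `Sel⁺(V'/F_∞)` at `γF` on the module `D.X × Dη.X`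
  let DF' : SignedSelmerDualData V' κF γF 1 :=
    { X := D.X × Dη.X
      conj_mem := fun s hs => conjH1_mem_signedSelmerInfty V' κF 1 γF hs
      toDual := T
      bijective := hTbij
      toDual_T_smul := by
        intro x s
        have h0 : (Φ ⟨V'.conjH1 p κF.kerSubgroup γF s,
            conjH1_mem_signedSelmerInfty V' κF 1 γF s.2⟩).1 =
            ⟨V.conjH1 p κ.kerSubgroup γ (Φ s).1, D.conj_mem _ (Φ s).1.2⟩ :=
          Subtype.ext (by rw [(hΦ s).1, hconj])
        have h1 : (Φ ⟨V'.conjH1 p κF.kerSubgroup γF s,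
            conjH1_mem_signedSelmerInfty V' κF 1 γF s.2⟩).2 =
            ⟨V.conjH1 p (towerTopSubgroup κ K₀) γ' (Φ s).2, Dη.conj_mem _ (Φ s).2.2⟩ :=
          Subtype.ext (hΦ s).2
        rw [hT, hT, hT, Prod.smul_fst, Prod.smul_snd, D.toDual_T_smul, Dη.toDual_T_smul, h0, h1]
        abel
      toDual_C_smul := by
        intro c x s k hk
        have hk' : (p ^ k) • Φ s = 0 := by rw [← map_nsmul, hk, map_zero]
        have hk0 : (p ^ k) • (Φ s).1 = 0 := by
          have h := congrArg Prod.fst hk'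
          rwa [Prod.smul_fst, Prod.fst_zero] at h
        have hk1 : (p ^ k) • (Φ s).2 = 0 := by
          have h := congrArg Prod.snd hk'
          rwa [Prod.smul_snd, Prod.snd_zero] at h
        rw [hT, hT, Prod.smul_fst, Prod.smul_snd, D.toDual_C_smul c x.1 _ k hk0,
          Dη.toDual_C_smul c x.2 _ k hk1, smul_add] }
  -- the product is finitely generated torsion with `Char = Char D.X · (Lη)`
  haveI : Module.Finite (IwasawaAlgebra p) D.X := hDfin
  haveI : Module.Finite (IwasawaAlgebra p) Dη.X := hηfin
  have hPfin : Module.Finite (IwasawaAlgebra p) (D.X × Dη.X) := inferInstance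
  have hPtor : Module.IsTorsion (IwasawaAlgebra p) (D.X × Dη.X) :=
    isTorsion_prod_of_isTorsion hDtor hηtor
  have hPchar : Module.charIdeal (IwasawaAlgebra p) (D.X × Dη.X) =
      Module.charIdeal (IwasawaAlgebra p) D.X * Module.charIdeal (IwasawaAlgebra p) Dη.X :=
    charIdeal_mul_of_shortExact_holds p (D.X × Dη.X) hPtor
      (LinearMap.inl (IwasawaAlgebra p) D.X Dη.X) (LinearMap.snd (IwasawaAlgebra p) D.X Dη.X)
      LinearMap.inl_injective LinearMap.snd_surjective .inl_snd
  -- transport to the GIVEN datum `DF` along the uniqueness isomorphism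
  obtain ⟨e, -⟩ := SignedSelmerDualData.exists_linearEquiv DF DF'
  have hfinF : Module.Finite (IwasawaAlgebra p) DF.X :=
    (SignedSelmerDualData.moduleFinite_iff DF DF').mpr hPfin
  have htorF : Module.IsTorsion (IwasawaAlgebra p) DF.X :=
    (SignedSelmerDualData.isTorsion_iff DF DF').mpr hPtor
  refine ⟨hfinF, htorF, ?_⟩
  change Module.charIdeal (IwasawaAlgebra p) DF.X =
    Module.charIdeal (IwasawaAlgebra p) D.X * Ideal.span {Lη}
  have hηchar' : Module.charIdeal (IwasawaAlgebra p) Dη.X = Ideal.span {Lη} := hηchar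
  rw [Module.charIdeal_eq_of_linearEquiv e, ← hηchar']
  exact hPchar

/-- **The `F`-form crux (C1_η) `PlusMainConjectureBranch` FROM the VERBATIM `η`-component even main
conjecture, granted the descent frame and Kobayashi's Thm. 1.2** — the converse of seat k8q-c3's
`etaTransportPlus_of_decomposition`, at the route level. Hypotheses, all displayed: `h12` = the
NAMED fact `Kobayashi2003.thm12_signedSelmerDual_finite_torsion`; `hdec` = the prime-to-`p` descent
frame (reading flag `Kob03-MC-eta-quadratic-subtower`) in ∀-form — for EVERY `p ≥ 5`, cyclotomic
`K₀`, quadratic `ηq`, good `a_p = 0` curve `V`, generator `γ ∈ Gal(ℚ̄/K₀)` matching the variable,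
and EVERY quadratic model admissible for (C1_η), an additive isomorphism
`Φ : Sel⁺(V'/F_∞) ≃ Sel⁺(V/ℚ_∞) × Sel⁺(V/K₀ℚ_∞)^η` intertwining `conj_{γF}` with `conj_γ` (WANTED;
not proved here); `hMCη` = Kobayashi's even main conjecture AT `η` on the `η`-component object (§4
p. 8 verbatim "`Char(X⁺(E/K_∞)^η) = (L_p⁺(E, η, X))`" with Thm. 2.2's finite generation and
torsion; the frame of the first conjunct of `EtaTransportSigned` WITHOUT its (C1_η) antecedent; an
OPEN CONJECTURE, hypothesis position). Conclusion: the route decl, literally; `K₀ := ℚ(ζ_p)`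
(`CyclotomicField`), `η` from `exists_theta_eta_cyclotomicField`. So, modulo the frame and Thm. 1.2,
the `F`-form crux and the verbatim `η`-form are EQUIVALENT. CONDITIONAL; closes nothing.
[cite: Kobayashi2003, Thm. 1.2 (p. 2), Def. 2.1 and Thm. 2.2 (p. 5), §3 (p. 5), §4 Even main conjecture (p. 8)]
[cite: GreenbergLNM1716, §1 (p. 60) and §3 (descent in prime-to-p extensions; reading)] -/
theorem plusMainConjectureBranch_of_etaPlusMainConjecture_of_decomposition
    (h12 : thm12_signedSelmerDual_finite_torsion)
    (hdec : ∀ (p : ℕ) [Fact p.Prime], 5 ≤ p →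
      ∀ (K₀ : Type) [Field K₀] [NumberField K₀] [IsCyclotomicExtension {p} ℚ K₀]
        [(galRange (K := ℚ) K₀).Normal] (ηq : absoluteGaloisGroup ℚ →* ℤˣ),
        (∀ σ ∈ galRange (K := ℚ) K₀, ηq σ = 1) → ηq ≠ 1 →
      ∀ (V : WeierstrassCurve ℚ) [V.IsElliptic] [V.IsGloballyMinimal],
        V.HasGoodReductionAtPrime p → V.frobeniusTrace p = 0 →
      ∀ (κ : ZpExtension ℚ p) (γ : absoluteGaloisGroup ℚ),
        κ.IsCyclotomic → κ.IsTopGenerator γ → γ ∈ galRange (K := ℚ) K₀ →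
        IsCyclotomicVariable p γ →
      ∀ (F : Type) [Field F] [NumberField F] (V' : WeierstrassCurve F) [V'.IsElliptic]
        (κF : ZpExtension F p) (γF : absoluteGaloisGroup F),
        Module.finrank ℚ F = 2 → (∃ θ : F, θ ^ 2 = algebraMap ℚ F ((-1) ^ (p / 2) * p)) →
        (∃ C : VariableChange F, C • V.baseChange F = V') →
        κF.IsCyclotomic → κF.IsTopGenerator γF →
        (∃ ζ : ℤ_[p]ˣ, IsOfFinOrder ζ ∧
          ((GaloisRep.cyclotomicCharacter F p γF * ζ : ℤ_[p]ˣ) : ℤ_[p]) =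
            (cyclotomicGenerator p : ℤ_[p])) →
      ∃ Φ : signedSelmerInfty V' κF 1 ≃+
          signedSelmerInfty V κ 1 × towerSignedSelmerInftyEta V κ K₀ ℚ_[p] ηq 1,
        ∀ s : signedSelmerInfty V' κF 1,
          ((Φ ⟨V'.conjH1 p κF.kerSubgroup γF s,
              conjH1_mem_signedSelmerInfty V' κF 1 γF s.2⟩).1 : V.subgroupH1 p κ.kerSubgroup) =
            V.conjH1 p κ.kerSubgroup γ (Φ s).1 ∧
          ((Φ ⟨V'.conjH1 p κF.kerSubgroup γF s,
              conjH1_mem_signedSelmerInfty V' κF 1 γF s.2⟩).2 :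
              V.subgroupH1 p (towerTopSubgroup κ K₀)) =
            V.conjH1 p (towerTopSubgroup κ K₀) γ (Φ s).2)
    (hMCη : ∀ (p : ℕ) [Fact p.Prime], 5 ≤ p →
      ∀ (K₀ : Type) [Field K₀] [NumberField K₀] [IsCyclotomicExtension {p} ℚ K₀]
        [(galRange (K := ℚ) K₀).Normal] (ηq : absoluteGaloisGroup ℚ →* ℤˣ),
        (∀ σ ∈ galRange (K := ℚ) K₀, ηq σ = 1) → ηq ≠ 1 →
      ∀ (V : WeierstrassCurve ℚ) [V.IsElliptic] [V.IsGloballyMinimal] {N : ℕ} [NeZero N]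
        {f : CuspForm (Gamma0 N) 2},
        p ≠ 2 → V.HasGoodReductionAtPrime p → V.frobeniusTrace p = 0 → IsNewformOf V f →
      ∀ (ϖ : ℚ), (if Even (p / 2) then (ϖ : ℝ) * V.realPeriodRat = plusPeriod f
          else (ϖ : ℝ) * V.imaginaryPeriodRat = minusPeriod f) →
      ∀ (Lη : IwasawaAlgebra p), IsQuadraticBranchPlusLFunction f p ϖ Lη →
      ∀ (κ : ZpExtension ℚ p) (γ : absoluteGaloisGroup ℚ),
        κ.IsCyclotomic → κ.IsTopGenerator γ → γ ∈ galRange (K := ℚ) K₀ →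
        IsCyclotomicVariable p γ →
      ∀ (D : EtaSignedSelmerDualData V κ K₀ ℚ_[p] ηq γ 1),
        Module.Finite (IwasawaAlgebra p) D.X ∧ Module.IsTorsion (IwasawaAlgebra p) D.X ∧
          D.charIdeal = Ideal.span {Lη}) :
    PlusMainConjectureBranch := by
  intro V _ _ p _ hp5 hgood hap
  have hp2 : p ≠ 2 := by omega
  -- `K₀ = ℚ(ζ_p)` and the quadratic character `η`
  haveI : NeZero p := ⟨(Fact.out : p.Prime).ne_zero⟩
  haveI : IsCyclotomicExtension {p} ℚ (CyclotomicField p ℚ) :=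
    CyclotomicField.isCyclotomicExtension p ℚ
  haveI : (galRange (K := ℚ) (CyclotomicField p ℚ)).Normal := normal_galRange_cyclotomic p _
  obtain ⟨θ, ηq, -, -, -, hηK, hη1⟩ := exists_theta_eta_cyclotomicField p hp2
  exact quadraticBranchPlusMainConjectureAt_of_etaPlusMainConjecture_of_decomposition h12
    (CyclotomicField p ℚ) ηq
    (fun κ γ hκ hγ hγK hγc F _ _ V' _ κF γF hF hθ hC hκF hγF hζ =>
      hdec p hp5 (CyclotomicField p ℚ) ηq hηK hη1 V hgood hap κ γ hκ hγ hγK hγc F V' κF γF hF hθ hC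
        hκF hγF hζ)
    (fun hp2' hgood' hap' hf ϖ hϖ Lη hL κ γ hκ hγ hγK hγc Dη =>
      hMCη p hp5 (CyclotomicField p ℚ) ηq hηK hη1 V hp2' hgood' hap' hf ϖ hϖ Lη hL κ γ hκ hγ hγK
        hγc Dη)

end Summit.BirchSwinnertonDyer.BirchSwinnertonDyer.Theorems

end
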